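import Literature.MathematicalPhysics.QuantumFieldTheory.Dimock2011to13.QED3BlockingGeometry
import HarnessLib

/-!
# Dimock, *QED on the 3-torus. II*, §2.1 (92) + §3.1 (122)–(123), (126) ⟹ §3.2 p.27 L61–62
# «`□^{(5)} ⊂ δΛ^{(k)}_i ∪ δΛ^{(k)}_{i+1}`»: the corridor condition (92) keeps a neighbourhood of a `D_i` block inside two
# consecutive layers — PROVED in the index coordinates of the tree's `QED3BlockingGeometry`

statement-level skeleton of published theorems with citation tags; proofs where landed; nothing here is a claim about the Yang–Mills mass gap

**Citation header (reproduction of PUBLISHED work).** J. Dimock, *Quantum electrodynamics on the 3-torus. II*,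
arXiv:math-ph/0407063 [Dimock2004QED3TorusII], **§2.1 «blocking»** (90)–(92) p.16 L38–49, **§3.1** (120)–(123)
p.20 L19–69, (126) p.21 L11–15, **§3.2** THEOREM 1 p.22 L22–23, proof of LEMMA 2 Part III p.27 L61–62, of the held arXiv
text layer `paper:arxiv-math-ph_0407063` (`p.NN Lnn` = PDF page ∕ text-layer line).  Writer seat p11
(literature-prover-lit-balaban-p11-g23-0), YM LIT SWEEP item (c) D13 (row C13 «WHERE»; zero weight for the
YM-INPRINT tokens).  Builds on the tree's `QED3BlockingGeometry` ((87)–(94), (120)–(121) in block-index coordinates).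

**The printed text.** (90)–(92) p.16 L38–49: *"Our regions will be a sequence of the form `Λ = (Λ_0, …, Λ_{k−1})` (90)
where `Λ_j ⊂ T⁰_{N+M−j}` is a union of `LM_0 = L^{m_0+1}` blocks … We assume the sets are decreasing in the sense that
they satisfy one of the equivalent `B_1Λ_{j+1} ⊂ Λ_j`, `Λ_j ⊂ U_1Λ_{j−1} = L^{−1}Λ′_{j−1}` (91)  We also assume that for
some positive integer `r`  `d((L^{−1}Λ′_{j−1})^c, Λ_j) ≥ rM_0` (92) whenever both subsets are non-empty.  This insures
that the corridor between successive regions is at least a few `M_0` blocks wide."*  (122)–(123) p.20 L49–69: *"Let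
`D⁰_i` be the `L^{−(k−i)}M_0` blocks in `δΛ^{(k)}_i` denoted `□` … (122) which is a partition of `L^{−k}Λ_0` into blocks
of various sizes.  Actually it is convenient to modify this by taking (for `i ≥ 2`) `r_0` layers of `L^{−(k−i)}M_0`
blocks in `δΛ^{(k)}_i` along the boundary of `L^{−k}B_{i−1}Λ_{i−1}` and further subdividing them into
`L^{−(k−i+1)}M_0` blocks.  We assume that `r_0` is some fraction of `r` so that we do not exhaust `δΛ^{(k)}_i`.  Let
`D_i` be the new `L^{−(k−i)}M_0` blocks.  These are either in `δΛ^{(k)}_i` or `δΛ^{(k)}_{i+1}` … (123)"*.  (126) p.21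
L11–15: *"We also define some enlargements of each `L^{−(k−i)}M_0` cube `□ ∈ D_i`.  We set `□̃ = 3M_0L^{−(k−i)}` cube
centered on `□`, `□^{(n)} = (1 + 2n)r_1M_0L^{−(k−i)}` cube centered on `□` (126) for some `r_1 < r_0`."*  THEOREM 1
p.22 L22–23: *"`S_{k,Λ,ω}(A)` depends on `A` only in `⋃_{□∈ω}□^{(5)}`."*  p.27 L61–62: *"Now consider
`x, y ∈ L^{−k}Ω_0(□) ⊂ □^{(5)}`.  Assuming `5r_1 < r_0` we have `□^{(5)} ⊂ δΛ^{(k)}_i ∪ δΛ^{(k)}_{i+1}`."*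

**What is formalized (kernel-checked, zero `sorry`; the tree's `QED3BlockingGeometry` + Mathlib).**  In the index
coordinates of `QED3BlockingGeometry` (`L = 2a+1`; a site of `T^{−k}_{N+M−k}` is `x : ι → ℤ`; `ν^s(x) = centreIter a s x`
is the index of the `L^s`-cube containing `x`; `B_s = blockUpIter a s`, `U_1 = unblock a`; the layer `δΛ^{(k)}_l` is
`B_lδΛ_l = blockUpIter a l (deltaRegion a Λ l)`, (120)–(121)):
* §1 **the cubes `B_s` are `L^s`-Lipschitz for `ν^s`**: `halfWidth a s = (L^s − 1)∕2` (`two_mul_halfWidth_add_one`),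
  `centreIter_bounds` (`|L^s·ν^s(x)_μ − x_μ| ≤ (L^s−1)∕2`), and the separation transfer **`abs_sub_ge_of_centreIter`**:
  `n ≤ |ν^s(x)_μ − ν^s(z)_μ| ⟹ (n−1)L^s + 1 ≤ |x_μ − z_μ|` (coarse sup-distance `n` forces fine sup-distance `> (n−1)L^s`).
* §2 **(92) as a definition**: `Corridor a ϱ Λ j` :↔ every index point within sup-distance `< ϱ` of a point of `Λ_j`
  lies in `U_1Λ_{j−1}` (`ϱ = rM_0`); and the layer facts from (91), (93)–(94), (120): `centreIter_mem_of_mem_layer`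
  (`x ∈ B_lδΛ_l`, `l ≥ i+1` ⟹ `ν^i(x) ∈ Λ_i`), `centreIter_not_mem_unblock_of_mem_layer` (`x ∈ B_lδΛ_l`, `1 ≤ l ≤ i−1` ⟹
  `ν^i(x) ∉ U_1Λ_{i−1}`), `centreIter_succ_not_mem_unblock_of_mem_layer` (`x ∈ B_iδΛ_i` ⟹ `ν^{i+1}(x) ∉ U_1Λ_i`).
* §3 **the corridor separates non-adjacent layers** (the content of *"the corridor between successive regions is at
  least a few `M_0` blocks wide"*): `corridor_sep` — under `Corridor a ϱ Λ i`, `ν^i(x) ∈ Λ_i` and `ν^i(z) ∉ U_1Λ_{i−1}`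
  force `(ϱ−1)L^i + 1 ≤ |x_μ − z_μ|` for some `μ`; hence `layer_far_of_le_of_ge` — a point of a layer `l ≤ i−1` and a point
  of a layer `l′ ≥ i+1` are at sup-distance `> (ϱ−1)L^i`.
* §4 **p.27 L61–62 for the two kinds of `D_i` blocks of (123)**, with the enlargement `□^{(5)}` (126) rendered as "all `z`
  with `|z_μ − x_μ| ≤ W ∀μ` for some `x ∈ □`" and the numerical conditions on `W` explicit:
  **`layer_window_deep`** — `x ∈ B_iδΛ_i` whose `L^i`-cube index is DEEP (`every ω′` within sup-distance `ϱ₀ = r_0M_0` of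
  `ν^i(x)` lies in `U_1Λ_{i−1}`: the unsubdivided blocks of `D_i`), `Corridor a ϱ Λ (i+1)`, `W ≤ ϱ₀L^i`,
  `W ≤ (ϱ−1)L^{i+1}`: every `z` in the window lying in a layer `B_lδΛ_l` (`1 ≤ l ≤ k`) has `l = i ∨ l = i+1`;
  **`layer_window_shallow`** — `x ∈ B_{i+1}δΛ_{i+1}` whose `L^{i+1}`-cube index is SHALLOW (within `ϱ₀` of a point outside
  `U_1Λ_i`: the subdivided boundary blocks, now in `D_i`), `Corridor` at `i` and `i+1`, `W ≤ (ϱ−1)L^i`,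
  `W ≤ (ϱ−ϱ₀−1)L^{i+1}`: the same conclusion.  For `□ ∈ D_i` (an `M_0L^i`-cube in index units) and `z ∈ □^{(5)}`
  ((126): the `11r_1M_0L^i`-cube concentric with `□`) one has `|z_μ − x_μ| ≤ 6r_1M_0L^i =: W` for any `x ∈ □` (`r_1 ≥ 1`),
  and the conditions read `6r_1 ≤ r_0`, `6r_1M_0 ≤ rM_0 − 1` (hence `≤ (rM_0 − 1)L`), `6r_1M_0 ≤ ((r − r_0)M_0 − 1)L` —
  this file's sufficient form of the printed *"`5r_1 < r_0`"*, *"`r_1 < r_0`"*, *"`r_0` is some fraction of `r`"*.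
* §5 (v1.1, append-only) **the literal containment** `□^{(5)} ⊂ δΛ^{(k)}_i ∪ δΛ^{(k)}_{i+1}`: with `1 ≤ i` and `Λ_k = ∅`,
  `window_subset_layers_deep` ∕ `window_subset_layers_shallow` — EVERY `z` of the window lies in `B_iδΛ_i` or
  `B_{i+1}δΛ_{i+1}` (points outside `Λ_0` are excluded by the same separation, `centreIter_not_mem_unblock_of_not_mem_zero`;
  points of `Λ_0` lie in some layer by the tree's `eq121`).

**Honest scope.** The block families `D⁰_i`, `D_i` themselves ((122)–(123) as finsets of `M_0`-cubes) are not built: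
the two theorems are stated for a POINT `x` of the block with the deep∕shallow property of its `L^i`- (resp. `L^{i+1}`-)
cube index, which is what membership in an unsubdivided (resp. subdivided) block of (123) provides; `M_0` enters only
through `ϱ = rM_0`, `ϱ₀ = r_0M_0` and `W`.  No torus identification (index coordinates on `ℤ^ι`, as in
`QED3BlockingGeometry`).  Not here: the partition of unity (124)–(125) (the tree's `QED3SquarePartitionOfUnity`), the
metric (127), the region `Ω(□)` of LEMMA 2 and the `A`-dependence clause of THEOREM 1 itself.  No named facts
(`def … : Prop` without proof obligations) are introduced — `Corridor` is the hypothesis (92) with a body.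
-/

namespace Literature.MathematicalPhysics.QuantumFieldTheory.Dimock2011to13

namespace QED3TorusII

open Finset

variable {ι : Type*} [Fintype ι] [DecidableEq ι]

/-! ## §1 The cubes `B_s` are `L^s`-Lipschitz for the index map `ν^s` -/

/-- half-width of an `L^s`-cube: `(L^s − 1)∕2`, recursively `h_{s+1} = L·h_s + a` (`L = 2a+1`).
[cite: Dimock2004QED3TorusII, §2.1 (89) p.16 L29–36] -/
def halfWidth (a : ℕ) : ℕ → ℕ
  | 0 => 0
  | s + 1 => (2 * a + 1) * halfWidth a s + a

omit [Fintype ι] [DecidableEq ι] in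
/-- `2h_s + 1 = L^s`. [cite: Dimock2004QED3TorusII, §2.1 (89) p.16 L29–36] -/
theorem two_mul_halfWidth_add_one (a : ℕ) : ∀ s : ℕ, (2 * halfWidth a s + 1 : ℤ) = (2 * a + 1 : ℤ) ^ s
  | 0 => by simp [halfWidth]
  | s + 1 => by
      have ih := two_mul_halfWidth_add_one a s
      simp only [halfWidth, Nat.cast_add, Nat.cast_mul, Nat.cast_ofNat, Nat.cast_one, pow_succ]
      nlinarith [ih]

omit [Fintype ι] [DecidableEq ι] in
/-- `x_μ − a ≤ L·ν(x)_μ ≤ x_μ + a`: a point lies in the `L`-cube about `L·ν(x)`.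
[cite: Dimock2004QED3TorusII, §2.1 (87)–(88) p.16 L8–25] -/
theorem smul_centre_bounds (a : ℕ) (x : ι → ℤ) (μ : ι) :
    x μ - a ≤ (2 * a + 1 : ℤ) * centre a x μ ∧ (2 * a + 1 : ℤ) * centre a x μ ≤ x μ + a := by
  have h := (centre_eq_iff (a := a) (x := x) (c := centre a x)).1 rfl μ
  obtain ⟨h1, h2⟩ := h
  rw [mul_comm] at h1
  rw [add_mul, one_mul, mul_comm] at h2
  constructor <;> linarith

omit [Fintype ι] [DecidableEq ι] in
/-- `|L^s·ν^s(x)_μ − x_μ| ≤ h_s = (L^s − 1)∕2`: a point lies in the `L^s`-cube about `L^s·ν^s(x)`.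
[cite: Dimock2004QED3TorusII, §2.1 (89) p.16 L29–36] -/
theorem centreIter_bounds (a : ℕ) : ∀ (s : ℕ) (x : ι → ℤ) (μ : ι),
    x μ - halfWidth a s ≤ (2 * a + 1 : ℤ) ^ s * centreIter a s x μ ∧
      (2 * a + 1 : ℤ) ^ s * centreIter a s x μ ≤ x μ + halfWidth a s
  | 0, x, μ => by simp [halfWidth, centreIter]
  | s + 1, x, μ => by
      have ih := centreIter_bounds a s (centre a x) μ
      have h0 := smul_centre_bounds a x μ
      have hL : (0 : ℤ) ≤ (2 * a + 1 : ℤ) ^ s := by positivity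
      have e : (2 * a + 1 : ℤ) ^ (s + 1) * centreIter a (s + 1) x μ
          = (2 * a + 1 : ℤ) * ((2 * a + 1 : ℤ) ^ s * centreIter a s (centre a x) μ) := by
        rw [pow_succ]; simp only [centreIter]; ring
      have hw : (halfWidth a (s + 1) : ℤ) = (2 * a + 1 : ℤ) * halfWidth a s + a := by
        simp [halfWidth]
      rw [e, hw]
      have h1 := mul_le_mul_of_nonneg_left ih.1 (show (0 : ℤ) ≤ 2 * a + 1 by positivity)
      have h2 := mul_le_mul_of_nonneg_left ih.2 (show (0 : ℤ) ≤ 2 * a + 1 by positivity)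
      rw [mul_sub] at h1
      rw [mul_add] at h2
      constructor <;> nlinarith [h0.1, h0.2, h1, h2]

omit [Fintype ι] [DecidableEq ι] in
/-- **Separation transfer from scale `s` to scale `0`**: if the `L^s`-cube indices of `x` and `z` differ by `≥ n` in
the coordinate `μ`, then `|x_μ − z_μ| ≥ nL^s − (L^s − 1) = (n−1)L^s + 1`.
[cite: Dimock2004QED3TorusII, §2.1 (89), (92) p.16 L29–49] -/
theorem abs_sub_ge_of_centreIter (a s : ℕ) {x z : ι → ℤ} {μ : ι} {n : ℤ}
    (h : n ≤ |centreIter a s x μ - centreIter a s z μ|) :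
    (n - 1) * (2 * a + 1 : ℤ) ^ s + 1 ≤ |x μ - z μ| := by
  have hx := centreIter_bounds a s x μ
  have hz := centreIter_bounds a s z μ
  have hw := two_mul_halfWidth_add_one a s
  have hL : (0 : ℤ) ≤ (2 * a + 1 : ℤ) ^ s := by positivity
  rcases le_abs.1 h with h' | h'
  · have h1 := mul_le_mul_of_nonneg_right h' hL
    rw [sub_mul] at h1
    have : (n - 1) * (2 * a + 1 : ℤ) ^ s + 1 ≤ x μ - z μ := by nlinarith [hx.1, hx.2, hz.1, hz.2]
    exact this.trans (le_abs_self _)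
  · have h1 := mul_le_mul_of_nonneg_right h' hL
    rw [neg_sub, sub_mul] at h1
    have : (n - 1) * (2 * a + 1 : ℤ) ^ s + 1 ≤ z μ - x μ := by nlinarith [hx.1, hx.2, hz.1, hz.2]
    exact this.trans (by rw [abs_sub_comm]; exact le_abs_self _)

/-! ## §2 The corridor condition (92) and the layers -/

/-- **(92)** `d((L^{−1}Λ′_{j−1})^c, Λ_j) ≥ ϱ` in the sup metric of the scale-`j` index lattice (`ϱ = rM_0`): every index
point within sup-distance `< ϱ` of a point of `Λ_j` belongs to `U_1Λ_{j−1} = L^{−1}Λ′_{j−1}`.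
[cite: Dimock2004QED3TorusII, §2.1 (92) p.16 L45–49] -/
def Corridor (a ϱ : ℕ) (Λ : ℕ → Finset (ι → ℤ)) (j : ℕ) : Prop :=
  ∀ ω ∈ Λ j, ∀ ω' : ι → ℤ, (∀ μ, |ω' μ - ω μ| < ϱ) → ω' ∈ unblock a (Λ (j - 1))

omit [DecidableEq ι] in
/-- for a block union, `ω ∈ Λ ↔ ν(ω) ∈ U_1Λ`. [cite: Dimock2004QED3TorusII, §2.1 (87)–(88) p.16 L15–25] -/
theorem mem_iff_centre_mem_unblock {a : ℕ} {Λ : Finset (ι → ℤ)} (h : IsBlockUnion a Λ) (ω : ι → ℤ) :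
    ω ∈ Λ ↔ centre a ω ∈ unblock a Λ := by
  rw [mem_unblock]; exact h ω

section Layers

variable {a : ℕ} {Λ : ℕ → Finset (ι → ℤ)} {k : ℕ}

/-- **inner layers sit over `Λ_i`**: `x ∈ B_lδΛ_l` with `i+1 ≤ l ≤ k` ⟹ `ν^i(x) ∈ Λ_i` ((94): `B_iΛ_i ⊇ B_lδΛ_l`).
[cite: Dimock2004QED3TorusII, §2.1 (91), (93)–(94) p.16 L41–56; §3.1 (120) p.20 L19–30] -/
theorem centreIter_mem_of_mem_layer (hblock : ∀ j < k, IsBlockUnion a (Λ j))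
    (hdec : ∀ j < k, Λ (j + 1) ⊆ unblock a (Λ j)) {i l : ℕ} (hil : i + 1 ≤ l) (hlk : l ≤ k) {x : ι → ℤ}
    (hx : x ∈ blockUpIter a l (deltaRegion a Λ l)) : centreIter a i x ∈ Λ i := by
  rw [mem_blockUpIter] at hx
  unfold deltaRegion at hx
  have h1 : centreIter a l x ∈ unblock a (Λ (l - 1)) := (mem_sdiff.1 hx).1
  -- `ν^l = ν ∘ ν^{l−1}`, so `ν^{l−1}(x) ∈ Λ_{l−1}` (block union)
  obtain ⟨m, rfl⟩ : ∃ m, l = m + 1 := ⟨l - 1, by omega⟩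
  rw [centreIter_succ'] at h1
  have h2 : centreIter a m x ∈ Λ m := by
    have hm : m < k := by omega
    rw [Nat.add_sub_cancel] at h1
    exact (mem_iff_centre_mem_unblock (hblock m hm) _).2 h1
  -- descend from `m` to `i`
  obtain ⟨s, rfl⟩ : ∃ s, m = i + s := ⟨m - i, by omega⟩
  rw [centreIter_add] at h2
  exact mem_of_centreIter_mem hblock hdec s i (centreIter a i x) (by omega) h2

/-- **outer layers sit outside `U_1Λ_{i−1}`**: `x ∈ B_lδΛ_l` with `1 ≤ l ≤ i−1`, `i−1 < k` ⟹ `ν^i(x) ∉ U_1Λ_{i−1}`.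
[cite: Dimock2004QED3TorusII, §2.1 (91), (93)–(94) p.16 L41–56; §3.1 (120) p.20 L19–30] -/
theorem centreIter_not_mem_unblock_of_mem_layer (hblock : ∀ j < k, IsBlockUnion a (Λ j))
    (hdec : ∀ j < k, Λ (j + 1) ⊆ unblock a (Λ j)) {i l : ℕ} (hl1 : 1 ≤ l) (hli : l + 1 ≤ i) (hik : i ≤ k)
    {x : ι → ℤ} (hx : x ∈ blockUpIter a l (deltaRegion a Λ l)) :
    centreIter a i x ∉ unblock a (Λ (i - 1)) := by
  rw [mem_blockUpIter] at hx
  unfold deltaRegion at hx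
  have h1 : centreIter a l x ∉ Λ l := (mem_sdiff.1 hx).2
  intro h
  apply h1
  -- `ν^i(x) ∈ U_1Λ_{i−1}` ⟹ `ν^{i−1}(x) ∈ Λ_{i−1}` (block union) ⟹ `ν^l(x) ∈ Λ_l` (descent)
  obtain ⟨m, rfl⟩ : ∃ m, i = m + 1 := ⟨i - 1, by omega⟩
  rw [Nat.add_sub_cancel] at h
  rw [centreIter_succ'] at h
  have h2 : centreIter a m x ∈ Λ m := (mem_iff_centre_mem_unblock (hblock m (by omega)) _).2 h
  obtain ⟨s, rfl⟩ : ∃ s, m = l + s := ⟨m - l, by omega⟩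
  rw [centreIter_add] at h2
  exact mem_of_centreIter_mem hblock hdec s l (centreIter a l x) (by omega) h2

/-- **a `δΛ_i` point is outside `Λ_i`, one scale up**: `x ∈ B_iδΛ_i`, `i < k` ⟹ `ν^{i+1}(x) ∉ U_1Λ_i`.
[cite: Dimock2004QED3TorusII, §2.1 (93) p.16 L50–53] -/
theorem centreIter_succ_not_mem_unblock_of_mem_layer (hblock : ∀ j < k, IsBlockUnion a (Λ j)) {i : ℕ}
    (hik : i < k) {x : ι → ℤ} (hx : x ∈ blockUpIter a i (deltaRegion a Λ i)) :
    centreIter a (i + 1) x ∉ unblock a (Λ i) := by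
  rw [mem_blockUpIter] at hx
  unfold deltaRegion at hx
  have h1 : centreIter a i x ∉ Λ i := (mem_sdiff.1 hx).2
  rw [centreIter_succ', ← mem_iff_centre_mem_unblock (hblock i hik)]
  exact h1

end Layers

/-! ## §3 The corridor separates non-adjacent layers -/

omit [DecidableEq ι] in
/-- **Corridor separation**: under (92) at level `i`, a point over `Λ_i` and a point outside `U_1Λ_{i−1}` differ by
`≥ (ϱ−1)L^i + 1` in some coordinate. [cite: Dimock2004QED3TorusII, §2.1 (92) p.16 L45–49] -/
theorem corridor_sep {a ϱ : ℕ} {Λ : ℕ → Finset (ι → ℤ)} {i : ℕ} (hC : Corridor a ϱ Λ i) {x z : ι → ℤ}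
    (hx : centreIter a i x ∈ Λ i) (hz : centreIter a i z ∉ unblock a (Λ (i - 1))) :
    ∃ μ, ((ϱ : ℤ) - 1) * (2 * a + 1 : ℤ) ^ i + 1 ≤ |x μ - z μ| := by
  by_contra hcon
  push Not at hcon
  apply hz
  refine hC _ hx _ fun μ => ?_
  by_contra hμ
  push Not at hμ
  rw [abs_sub_comm] at hμ
  exact absurd (abs_sub_ge_of_centreIter a i hμ) (not_le.2 (hcon μ))

/-- **Non-adjacent layers are far apart**: under (92) at level `i`, a point of a layer `B_lδΛ_l` with `l ≤ i−1` and a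
point of a layer `B_{l′}δΛ_{l′}` with `l′ ≥ i+1` differ by `≥ (ϱ−1)L^i + 1` in some coordinate (*"the corridor between
successive regions is at least a few `M_0` blocks wide"*). [cite: Dimock2004QED3TorusII, §2.1 (92) p.16 L45–49] -/
theorem layer_far_of_le_of_ge {a ϱ : ℕ} {Λ : ℕ → Finset (ι → ℤ)} {k : ℕ} (hblock : ∀ j < k, IsBlockUnion a (Λ j))
    (hdec : ∀ j < k, Λ (j + 1) ⊆ unblock a (Λ j)) {i : ℕ} (hC : Corridor a ϱ Λ i) {l l' : ℕ} (hl1 : 1 ≤ l)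
    (hli : l + 1 ≤ i) (hil' : i + 1 ≤ l') (hl'k : l' ≤ k) {x z : ι → ℤ}
    (hx : x ∈ blockUpIter a l' (deltaRegion a Λ l')) (hz : z ∈ blockUpIter a l (deltaRegion a Λ l)) :
    ∃ μ, ((ϱ : ℤ) - 1) * (2 * a + 1 : ℤ) ^ i + 1 ≤ |x μ - z μ| :=
  corridor_sep hC (centreIter_mem_of_mem_layer hblock hdec hil' hl'k hx)
    (centreIter_not_mem_unblock_of_mem_layer hblock hdec hl1 hli (by omega) hz)

/-! ## §4 p.27 L61–62: a window about a `D_i` block meets only the layers `i` and `i+1` -/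

/-- **«`□^{(5)} ⊂ δΛ^{(k)}_i ∪ δΛ^{(k)}_{i+1}`», unsubdivided blocks of `D_i`.**  Let `x ∈ B_iδΛ_i` have a DEEP
`L^i`-cube index — every `ω′` within sup-distance `ϱ₀` (`= r_0M_0`) of `ν^i(x)` lies in `U_1Λ_{i−1}` (the blocks of (123)
left at distance `> r_0` layers from the boundary of `B_{i−1}Λ_{i−1}`) — and assume (92) at level `i+1` with `ϱ = rM_0`.
If `W ≤ ϱ₀L^i` and `W ≤ (ϱ−1)L^{i+1}`, then every point `z` with `|z_μ − x_μ| ≤ W` for all `μ` that lies in a layer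
`B_lδΛ_l`, `1 ≤ l ≤ k`, lies in the layer `i` or `i+1`.
[cite: Dimock2004QED3TorusII, §3.2 proof of Lemma 2 Part III p.27 L61–62; §3.1 (123) p.20 L64–69, (126) p.21 L11–15] -/
theorem layer_window_deep {a ϱ ϱ₀ : ℕ} {Λ : ℕ → Finset (ι → ℤ)} {k : ℕ} (hblock : ∀ j < k, IsBlockUnion a (Λ j))
    (hdec : ∀ j < k, Λ (j + 1) ⊆ unblock a (Λ j)) {i : ℕ} (hik : i < k)
    (hC : Corridor a ϱ Λ (i + 1)) {x : ι → ℤ} (hx : x ∈ blockUpIter a i (deltaRegion a Λ i))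
    (hdeep : ∀ ω' : ι → ℤ, (∀ μ, |ω' μ - centreIter a i x μ| ≤ ϱ₀) → ω' ∈ unblock a (Λ (i - 1)))
    {W : ℤ} (hW₁ : W ≤ ϱ₀ * (2 * a + 1 : ℤ) ^ i) (hW₂ : W ≤ ((ϱ : ℤ) - 1) * (2 * a + 1 : ℤ) ^ (i + 1))
    {z : ι → ℤ} (hz : ∀ μ, |z μ - x μ| ≤ W) {l : ℕ} (hl1 : 1 ≤ l) (hlk : l ≤ k)
    (hzl : z ∈ blockUpIter a l (deltaRegion a Λ l)) : l = i ∨ l = i + 1 := by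
  by_contra hne
  push Not at hne
  by_cases hlt : l < i
  · -- `l ≤ i−1`: `ν^i(z) ∉ U_1Λ_{i−1}`, contradicting the depth of `x`
    have h1 := centreIter_not_mem_unblock_of_mem_layer hblock hdec hl1 (by omega) hik.le hzl
    have h2 : ∃ μ, (ϱ₀ : ℤ) + 1 ≤ |centreIter a i z μ - centreIter a i x μ| := by
      by_contra hcon
      push Not at hcon
      exact h1 (hdeep _ fun μ => by have := hcon μ; omega)
    obtain ⟨μ, hμ⟩ := h2
    have h3 := abs_sub_ge_of_centreIter a i hμ
    have h4 := hz μ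
    have : (0 : ℤ) < (2 * a + 1 : ℤ) ^ i := by positivity
    nlinarith
  · -- `l ≥ i+2`: `ν^{i+1}(z) ∈ Λ_{i+1}` while `ν^{i+1}(x) ∉ U_1Λ_i`; corridor at `i+1`
    have hl2 : i + 2 ≤ l := by omega
    have h1 := centreIter_mem_of_mem_layer hblock hdec (by omega : i + 1 + 1 ≤ l) hlk hzl
    have h2 := centreIter_succ_not_mem_unblock_of_mem_layer hblock hik hx
    obtain ⟨μ, hμ⟩ := corridor_sep hC h1 (by rwa [Nat.add_sub_cancel])
    have h4 := hz μ
    linarith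

/-- **«`□^{(5)} ⊂ δΛ^{(k)}_i ∪ δΛ^{(k)}_{i+1}`», subdivided boundary blocks of `D_i`.**  Let `x ∈ B_{i+1}δΛ_{i+1}` have
a SHALLOW `L^{i+1}`-cube index — some `ω″ ∉ U_1Λ_i` within sup-distance `ϱ₀` (`= r_0M_0`) of `ν^{i+1}(x)` (the `r_0`
boundary layers of `δΛ^{(k)}_{i+1}` subdivided into `L^{−(k−i)}M_0` blocks and put in `D_i` by (123)) — and assume (92)
at levels `i` and `i+1` with `ϱ = rM_0`.  If `W ≤ (ϱ−1)L^i` and `W ≤ (ϱ−ϱ₀−1)L^{i+1}`, then every point `z` with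
`|z_μ − x_μ| ≤ W` for all `μ` that lies in a layer `B_lδΛ_l`, `1 ≤ l ≤ k`, lies in the layer `i` or `i+1`.
[cite: Dimock2004QED3TorusII, §3.2 proof of Lemma 2 Part III p.27 L61–62; §3.1 (123) p.20 L64–69, (126) p.21 L11–15] -/
theorem layer_window_shallow {a ϱ ϱ₀ : ℕ} {Λ : ℕ → Finset (ι → ℤ)} {k : ℕ} (hblock : ∀ j < k, IsBlockUnion a (Λ j))
    (hdec : ∀ j < k, Λ (j + 1) ⊆ unblock a (Λ j)) {i : ℕ} (hik : i + 1 ≤ k)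
    (hCi : Corridor a ϱ Λ i) (hC : Corridor a ϱ Λ (i + 1)) {x : ι → ℤ}
    (hx : x ∈ blockUpIter a (i + 1) (deltaRegion a Λ (i + 1)))
    (hshallow : ∃ ω'' : ι → ℤ, ω'' ∉ unblock a (Λ i) ∧ ∀ μ, |ω'' μ - centreIter a (i + 1) x μ| ≤ ϱ₀)
    {W : ℤ} (hW₁ : W ≤ ((ϱ : ℤ) - 1) * (2 * a + 1 : ℤ) ^ i)
    (hW₂ : W ≤ ((ϱ : ℤ) - ϱ₀ - 1) * (2 * a + 1 : ℤ) ^ (i + 1))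
    {z : ι → ℤ} (hz : ∀ μ, |z μ - x μ| ≤ W) {l : ℕ} (hl1 : 1 ≤ l) (hlk : l ≤ k)
    (hzl : z ∈ blockUpIter a l (deltaRegion a Λ l)) : l = i ∨ l = i + 1 := by
  by_contra hne
  push Not at hne
  by_cases hlt : l < i
  · -- `l ≤ i−1`: `ν^i(z) ∉ U_1Λ_{i−1}` while `ν^i(x) ∈ Λ_i`; corridor at `i`
    have h1 := centreIter_not_mem_unblock_of_mem_layer hblock hdec hl1 (by omega) (by omega : i ≤ k) hzl
    have h2 := centreIter_mem_of_mem_layer hblock hdec (le_refl (i + 1)) hik hx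
    obtain ⟨μ, hμ⟩ := corridor_sep hCi h2 h1
    have h4 := hz μ
    rw [abs_sub_comm] at h4
    linarith
  · -- `l ≥ i+2`: `ν^{i+1}(z) ∈ Λ_{i+1}`; the corridor at `i+1` about it contains no point outside `U_1Λ_i`
    have hl2 : i + 2 ≤ l := by omega
    have h1 := centreIter_mem_of_mem_layer hblock hdec (by omega : i + 1 + 1 ≤ l) hlk hzl
    obtain ⟨ω'', hω'', hnear⟩ := hshallow
    have h2 : ∃ μ, (ϱ : ℤ) ≤ |ω'' μ - centreIter a (i + 1) z μ| := by
      by_contra hcon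
      push Not at hcon
      apply hω''
      have := hC _ h1 ω'' hcon
      rwa [Nat.add_sub_cancel] at this
    obtain ⟨μ, hμ⟩ := h2
    have h3 : (ϱ : ℤ) - ϱ₀ ≤ |centreIter a (i + 1) x μ - centreIter a (i + 1) z μ| := by
      have t := abs_sub_abs_le_abs_sub (ω'' μ - centreIter a (i + 1) z μ) (ω'' μ - centreIter a (i + 1) x μ)
      have e : ω'' μ - centreIter a (i + 1) z μ - (ω'' μ - centreIter a (i + 1) x μ)
          = centreIter a (i + 1) x μ - centreIter a (i + 1) z μ := by ring
      rw [e] at t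
      linarith [hnear μ]
    have h5 := abs_sub_ge_of_centreIter a (i + 1) h3
    have h4 := hz μ
    rw [abs_sub_comm] at h4
    linarith

/-! ## §5 (v1.1) The literal containment: the window lies IN `δΛ^{(k)}_i ∪ δΛ^{(k)}_{i+1}` -/

section Literal

variable {a : ℕ} {Λ : ℕ → Finset (ι → ℤ)} {k : ℕ}

omit [DecidableEq ι] in
/-- **points outside `Λ_0` are outside every `U_1Λ_{i−1}` from scale `i`**: `z ∉ Λ_0`, `1 ≤ i ≤ k` ⟹
`ν^i(z) ∉ U_1Λ_{i−1}` (descent (91)). [cite: Dimock2004QED3TorusII, §2.1 (91) p.16 L41–44] -/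
theorem centreIter_not_mem_unblock_of_not_mem_zero (hblock : ∀ j < k, IsBlockUnion a (Λ j))
    (hdec : ∀ j < k, Λ (j + 1) ⊆ unblock a (Λ j)) {i : ℕ} (hi1 : 1 ≤ i) (hik : i ≤ k) {z : ι → ℤ}
    (hz : z ∉ Λ 0) : centreIter a i z ∉ unblock a (Λ (i - 1)) := by
  intro h
  apply hz
  obtain ⟨m, rfl⟩ : ∃ m, i = m + 1 := ⟨i - 1, by omega⟩
  rw [Nat.add_sub_cancel, centreIter_succ'] at h
  have h2 : centreIter a m z ∈ Λ m := (mem_iff_centre_mem_unblock (hblock m (by omega)) _).2 h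
  exact mem_of_centreIter_mem hblock hdec m 0 z (by omega) (by rwa [Nat.zero_add])

/-- **«`□^{(5)} ⊂ δΛ^{(k)}_i ∪ δΛ^{(k)}_{i+1}`» literally, unsubdivided blocks of `D_i`** (`1 ≤ i < k`, `Λ_k = ∅`): under
the hypotheses of `layer_window_deep`, EVERY `z` with `|z_μ − x_μ| ≤ W` for all `μ` lies in `B_iδΛ_i` or in
`B_{i+1}δΛ_{i+1}` — points outside `L^{−k}Λ_0` are excluded by the same depth argument, points of `Λ_0` lie in some layer
by (121). [cite: Dimock2004QED3TorusII, §3.2 proof of Lemma 2 Part III p.27 L61–62; §3.1 (121), (123) p.20 L42–69] -/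
theorem window_subset_layers_deep {ϱ ϱ₀ : ℕ} (hblock : ∀ j < k, IsBlockUnion a (Λ j))
    (hdec : ∀ j < k, Λ (j + 1) ⊆ unblock a (Λ j)) (hk : Λ k = ∅) {i : ℕ} (hi1 : 1 ≤ i) (hik : i < k)
    (hC : Corridor a ϱ Λ (i + 1)) {x : ι → ℤ} (hx : x ∈ blockUpIter a i (deltaRegion a Λ i))
    (hdeep : ∀ ω' : ι → ℤ, (∀ μ, |ω' μ - centreIter a i x μ| ≤ ϱ₀) → ω' ∈ unblock a (Λ (i - 1)))
    {W : ℤ} (hW₁ : W ≤ ϱ₀ * (2 * a + 1 : ℤ) ^ i) (hW₂ : W ≤ ((ϱ : ℤ) - 1) * (2 * a + 1 : ℤ) ^ (i + 1))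
    {z : ι → ℤ} (hz : ∀ μ, |z μ - x μ| ≤ W) :
    z ∈ blockUpIter a i (deltaRegion a Λ i) ∨ z ∈ blockUpIter a (i + 1) (deltaRegion a Λ (i + 1)) := by
  by_cases hz0 : z ∈ Λ 0
  · rw [eq121 a Λ k hblock hdec hk, mem_biUnion] at hz0
    obtain ⟨t, ht, hzt⟩ := hz0
    rw [mem_range] at ht
    rcases layer_window_deep hblock hdec hik hC hx hdeep hW₁ hW₂ hz (by omega : 1 ≤ t + 1) (by omega) hzt with
      h | h
    · left; rw [← h]; exact hzt
    · right; rw [← h]; exact hzt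
  · -- `z ∉ Λ_0`: then `ν^i(z) ∉ U_1Λ_{i−1}`, contradicting the depth of `x` as in `layer_window_deep`
    exfalso
    have h1 := centreIter_not_mem_unblock_of_not_mem_zero hblock hdec hi1 hik.le hz0
    have h2 : ∃ μ, (ϱ₀ : ℤ) + 1 ≤ |centreIter a i z μ - centreIter a i x μ| := by
      by_contra hcon
      push Not at hcon
      exact h1 (hdeep _ fun μ => by have := hcon μ; omega)
    obtain ⟨μ, hμ⟩ := h2
    have h3 := abs_sub_ge_of_centreIter a i hμ
    have h4 := hz μ
    have : (0 : ℤ) < (2 * a + 1 : ℤ) ^ i := by positivity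
    nlinarith

/-- **«`□^{(5)} ⊂ δΛ^{(k)}_i ∪ δΛ^{(k)}_{i+1}`» literally, subdivided boundary blocks of `D_i`** (`1 ≤ i`, `i+1 ≤ k`,
`Λ_k = ∅`): under the hypotheses of `layer_window_shallow`, EVERY `z` with `|z_μ − x_μ| ≤ W` for all `μ` lies in
`B_iδΛ_i` or in `B_{i+1}δΛ_{i+1}`.
[cite: Dimock2004QED3TorusII, §3.2 proof of Lemma 2 Part III p.27 L61–62; §3.1 (121), (123) p.20 L42–69] -/
theorem window_subset_layers_shallow {ϱ ϱ₀ : ℕ} (hblock : ∀ j < k, IsBlockUnion a (Λ j))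
    (hdec : ∀ j < k, Λ (j + 1) ⊆ unblock a (Λ j)) (hk : Λ k = ∅) {i : ℕ} (hi1 : 1 ≤ i) (hik : i + 1 ≤ k)
    (hCi : Corridor a ϱ Λ i) (hC : Corridor a ϱ Λ (i + 1)) {x : ι → ℤ}
    (hx : x ∈ blockUpIter a (i + 1) (deltaRegion a Λ (i + 1)))
    (hshallow : ∃ ω'' : ι → ℤ, ω'' ∉ unblock a (Λ i) ∧ ∀ μ, |ω'' μ - centreIter a (i + 1) x μ| ≤ ϱ₀)
    {W : ℤ} (hW₁ : W ≤ ((ϱ : ℤ) - 1) * (2 * a + 1 : ℤ) ^ i)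
    (hW₂ : W ≤ ((ϱ : ℤ) - ϱ₀ - 1) * (2 * a + 1 : ℤ) ^ (i + 1))
    {z : ι → ℤ} (hz : ∀ μ, |z μ - x μ| ≤ W) :
    z ∈ blockUpIter a i (deltaRegion a Λ i) ∨ z ∈ blockUpIter a (i + 1) (deltaRegion a Λ (i + 1)) := by
  by_cases hz0 : z ∈ Λ 0
  · rw [eq121 a Λ k hblock hdec hk, mem_biUnion] at hz0
    obtain ⟨t, ht, hzt⟩ := hz0
    rw [mem_range] at ht
    rcases layer_window_shallow hblock hdec hik hCi hC hx hshallow hW₁ hW₂ hz (by omega : 1 ≤ t + 1) (by omega)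
      hzt with h | h
    · left; rw [← h]; exact hzt
    · right; rw [← h]; exact hzt
  · -- `z ∉ Λ_0`: then `ν^i(z) ∉ U_1Λ_{i−1}` while `ν^i(x) ∈ Λ_i`; corridor at `i`
    exfalso
    have h1 := centreIter_not_mem_unblock_of_not_mem_zero hblock hdec hi1 (by omega) hz0
    have h2 := centreIter_mem_of_mem_layer hblock hdec (le_refl (i + 1)) hik hx
    obtain ⟨μ, hμ⟩ := corridor_sep hCi h2 h1
    have h4 := hz μ
    rw [abs_sub_comm] at h4
    linarith

end Literal

end QED3TorusII

end Literature.MathematicalPhysics.QuantumFieldTheory.Dimock2011to13
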